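import Summits.QuantumFields.YangMills.Theorems.AlphaInputsT3ACv3RecordSelXsChi
import Summits.QuantumFields.YangMills.Theorems.AlphaInputsT3ACv3Reg68LevelsOfFineRegular
import Summits.QuantumFields.YangMills.Theorems.AlphaInputsT3ACv3LocalSmallXOfLevels
import Summits.QuantumFields.YangMills.Theorems.AlphaInputsT3ACv3Reg68LocalOfRegions
import HarnessLib

/-!
# `AlphaInputsT3ACv3InClassSelXsOfNestedRegular` — B1 EDGES-A: THE IN-CLASS SELECTION ROW `InClassSelT3Xs` FROM A **NESTED-REGULAR CONSTRAINED SELECTION**, BY NAME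
# — the four plumbing rows of the B1 plan (r-68a ✓p611785, r-68b ✓p612074, r-loop ✓p612098, r-67 ✓p612001) knitted into ONE displayed supplier predicate
# `NestedRegularSelT3` = what print's (42)-minimiser map must be shown to satisfy (EDGES-B: ⇐ [Balaban1985Variational] Thm 1 at `famRegT3`, nested) — cell `ym3-torus`,
# crux stmt-QuantumFields-19936 (`HistoryTailL`, (O″χ) block B1; ★★OWNER RULING g26-№8), LEAD seat `ym-ust-19936-w1` (g3)

WHAT.  §1 the displayed predicate `AlphaInputsT3AC.NestedRegularSelT3 K Ut UkH` (hypothesis schema, never asserted): `UkH` is pinned to `Ut` at the trivial history, measurable,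
and at every ADMISSIBLE non-trivial history `h` of level `k ≤ K` and every datum `W` there are LEVEL-DEPENDENT radii `α_i` (inside the record's windows: [B4] Prop 2 smallness,
`α₀ ≤ C68·θ(K)`, `2L²α_{i−1} ≤ C68·θ(K−i)`, `α_j ≤ ½C68·g_jp(g_j)`) and FROZEN data `𝓥` such that `UkH k h W` is (2)∕(8)-regular on every region `Ω_i(h)` at radius `α_i·L^{−2i}`
(print's NESTED regularity, [Balaban1985UV3] p.267 l.1–3 + (68) p.273 = LQB `B10Eq68TorusRegularity.regAt_of_crit_nested`), has the plaquette variables of `𝓥 j` at the recorded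
plaquettes `P_j(h)` (constraint (3) there) with `𝓥 j` recorded-large (`stepWeight`'s ζ-clause), and — when `W` is charged — exact `k`-fold `ℰp`-averages `W` on the bonds of `Ω_k(h)`
((3) at the top level).  §2 ★★★ `AlphaInputsT3AC.inClassSelT3Xs_of_nestedRegularSel (hM₁ : 7·F.L + 3 ≤ 𝔠.M₁) : NestedRegularSelT3 K Ut UkH → InClassSelT3Xs K Ut UkH` — membership
in `𝒞_Xs(k,h,W)` conjunct by conjunct: `reg68LevelsSet` by ★w4 g4's `mem_reg68LevelsSet_of_plaqSmallOn_Omega`, `localSmallT3X` by ★w6 g2's `reg68LevelsSet_subset_localSmallT3X`,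
`reg68LocalSet` by ★w2 g3's `mem_reg68LocalSet_of_regionRegular_le`, `large67RecSet` by ★alpha-2 g7's `mem_large67RecSet_of_plaqHol_eq`, `top42Set` by the top clause; the only
record row displayed is `7·F.L + 3 ≤ 𝔠.M₁` (the collar; already a conjunct of every `PinnedPartsT3ACRec*`).
SO, BY NAME: **19936 ⇐ ⟨T8⟩ ∧ ⟨∀ odd L: the seam row `Large67CombOfRecT3` + a NESTED-REGULAR CONSTRAINED SELECTION + its Sect. B–C χ-data⟩** (`historyTailL_of_thm1In8_selXsDataRows_allL`
with `InClassSelT3Xs` supplied here); EDGES-B (LEAD plan, not this file): `NestedRegularSelT3` ⇐ `B11Thm1.Thm1At` at `famRegT3` (✓p612209) for every admissible measurable frozen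
selection, through LQB's nested-minimiser transport (`B10NestedMinimizer`, `regAt_of_crit_nested`) — the criticality-restriction law and the measurable selections displayed there.
HONEST FRAMING.  Plumbing only (composition of landed rows); `NestedRegularSelT3` is a HYPOTHESIS SCHEMA standing for print's Theorem 1 output at the regional carrier, NOT
proved; the stub 2′χ, the crux `HistoryTailL`, and any gap are NOT claimed; count-neutral helper (`--supports stmt-QuantumFields-19936`); registry untouched.  YM₃ on the
three-torus is rung R3 of the programme, NOT the Clay problem: nothing here bears on d = 4, infinite volume, or a mass gap.

References: T. Bałaban, Commun. Math. Phys. 102 (1985) 277–309 [Balaban1985Variational] ((2)–(3) p.278, Thm 1 (8) p.279); Commun. Math. Phys. 102 (1985) 255–275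
[Balaban1985UV3] ((7) p.257, (40)–(42) p.266, p.267 l.1–3, (67)–(68) p.273); Commun. Math. Phys. 98 (1985) 17–51 [Balaban1985Averaging] (Prop 2 (52)–(54) p.26).
-/

set_option autoImplicit false

noncomputable section

namespace Summit.QuantumFields.YangMills.Theorems

open MeasureTheory Set
open scoped Matrix.Norms.L2Operator
open Literature.MathematicalPhysics.QuantumFieldTheory.Balaban1983to89
open Literature.MathematicalPhysics.QuantumFieldTheory.Balaban1983to89.T3ContinuumYM3Torus
open Literature.MathematicalPhysics.QuantumFieldTheory.Balaban1983to89.T3UnitLawDensityEML (ℰp)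
open Literature.MathematicalPhysics.QuantumFieldTheory.Balaban1983to89.T3UnitScaleTilt (θBal)
open Literature.MathematicalPhysics.QuantumFieldTheory.Balaban1983to89.ExpMeanLog (deltaSU)
open Literature.MathematicalPhysics.QuantumFieldTheory.Balaban1983to89.B10 (pFun)
open Literature.MathematicalPhysics.QuantumFieldTheory.Balaban1983to89.B10Eq38TorusDomains (plaqsIn)
open Literature.MathematicalPhysics.QuantumFieldTheory.Balaban1983to89.B10Eq42TorusConstraint (bondsIn)
open Literature.MathematicalPhysics.QuantumFieldTheory.Balaban1985CMP102.Setting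
open Summit.QuantumFields.Balaban3D.Carriers
open Summit.QuantumFields.Balaban3D.Proofs.Primitives (AlphaConsts)

/-! ## §1 The displayed supplier predicate: a nested-regular constrained selection -/

section Defs

variable (F : T3Family) (𝔠 : AlphaConsts F.L (suGroupModel 2).N) (γ : ℝ) (hγ : 0 < γ) (hγ1 : γ ≤ (min 𝔠.gamma0 1) ^ 2)

/-- **NESTED-REGULAR CONSTRAINED SELECTION** (hypothesis schema, never asserted; the B1 target print's (42)-minimiser map is to meet — EDGES-B): a family of maps `UkH k h : SU(2)^{bonds_k} →
SU(2)^{bonds_0}` PINNED to `Ut` at the trivial history, MEASURABLE, and such that for every admissible non-trivial history `h` of level `k ≤ K` and every datum `W` there are radii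
`α : ℕ → ℝ` and frozen data `𝓥` with: (w) the radii positive and inside the record's windows ([Balaban1985Averaging] Prop 2 smallness `C₀(3)·L²α_i ≤ ⅓`, `2L²α_i ≤ 2δ₂∕(7L)²`;
`α₀ ≤ C68·θ(K)`; `2L²α_{i−1} ≤ C68·θ(K−i)` for `1 ≤ i ≤ k`; `α_j ≤ ½C68·g_jp(g_j)` for `j ≤ k`); (2) NESTED REGULARITY: every fine plaquette with all corners in `Ω_i(h)` has
`dist1 < α_i·L^{−2i}`, `i ≤ k` (print's (8) at level-dependent radii, [Balaban1985UV3] p.267 l.1–3); (3ʳ) at every recorded plaquette `p ∈ P_j(h)` the `j`-fold `ℰp`-average of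
`UkH k h W` has the plaquette variable of `𝓥 j` (print's (3) at the four bonds of `p`) and (ζ) `𝓥 j` is recorded-large there (`eps1Of ≤ dist1`); (3ᵗ) if `W` is CHARGED, the `k`-fold
`ℰp`-average of `UkH k h W` equals `W` on the bonds of `Ω_k(h)` (print's (3) at the top level). [cite: Balaban1985Variational, (2)–(3) p.278, Thm 1 (8) p.279; Balaban1985UV3, (42) p.266, p.267, (67)–(68) p.273] -/
def AlphaInputsT3AC.NestedRegularSelT3 (K : ℕ)
    (Ut : (k : ℕ) → GaugeField (F.P K) k (Matrix.specialUnitaryGroup (Fin 2) ℂ) → GaugeField (F.P K) 0 (Matrix.specialUnitaryGroup (Fin 2) ℂ))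
    (UkH : (k : ℕ) → Hist (F.P K) k → GaugeField (F.P K) k (Matrix.specialUnitaryGroup (Fin 2) ℂ) →
      GaugeField (F.P K) 0 (Matrix.specialUnitaryGroup (Fin 2) ℂ)) : Prop :=
  (∀ k, UkH k (Hist.triv (F.P K) k) = Ut k) ∧
  (∀ (k : ℕ) (h : Hist (F.P K) k), Measurable (UkH k h)) ∧
  (∀ (k : ℕ), k ≤ K → ∀ (h : Hist (F.P K) k),
    Hist.Admissible 𝔠.lane.carrier.M₁ (rcolOf (T3Scales F γ hγ (hγ1.trans (sq_min_one_le _ 𝔠.gamma0_pos)) K) 𝔠.lane.carrier) k h →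
    h ≠ Hist.triv (F.P K) k →
    ∀ (W : GaugeField (F.P K) k (Matrix.specialUnitaryGroup (Fin 2) ℂ)),
      ∃ (α : ℕ → ℝ) (𝓥 : (j : ℕ) → GaugeField (F.P K) j (Matrix.specialUnitaryGroup (Fin 2) ℂ)),
        -- (w) the radii and the record's windows
        (∀ i, i ≤ k → 0 < α i) ∧
        (∀ i, i ≤ k → (143 * ((7 : ℝ) ^ 2 / 4) ^ 2) * ((F.L : ℝ) ^ 2 * α i) ≤ 1 / 3 ∧
          2 * ((F.L : ℝ) ^ 2 * α i) ≤ 2 * deltaSU (Fin 2) / ((7 * F.L : ℕ) : ℝ) ^ 2) ∧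
        α 0 ≤ 𝔠.C68 * θBal F.L γ 𝔠.b₀ 𝔠.p₀ K ∧
        (∀ i, 1 ≤ i → i ≤ k → 2 * ((F.L : ℝ) ^ 2 * α (i - 1)) ≤ 𝔠.C68 * θBal F.L γ 𝔠.b₀ 𝔠.p₀ (K - i)) ∧
        (∀ j, j ≤ k → α j ≤ 𝔠.C68 / 2 * ((T3Scales F γ hγ (hγ1.trans (sq_min_one_le _ 𝔠.gamma0_pos)) K).gk j *
          pFun 𝔠.lane.carrier.b₀ 𝔠.lane.carrier.p₀ ((T3Scales F γ hγ (hγ1.trans (sq_min_one_le _ 𝔠.gamma0_pos)) K).gk j))) ∧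
        -- (2) nested regularity on the regions at the level-dependent radii
        (∀ i, i ≤ k → PlaqSmallOn (↑(plaqsIn 0 (Omega 𝔠.lane.carrier.M₁
            (rcolOf (T3Scales F γ hγ (hγ1.trans (sq_min_one_le _ 𝔠.gamma0_pos)) K) 𝔠.lane.carrier) k h i)) : Set (Plaq (F.P K) 0))
            (α i * (((F.L : ℝ) ^ i)⁻¹) ^ 2) (UkH k h W)) ∧
        -- (3ʳ) + (ζ) at the recorded plaquettes
        (∀ (j : Fin k) (p : Plaq (F.P K) j), p ∈ h j →
          GaugeField.plaqHol (Averaging.iter (fun l => BlockAveraging.blockAvg (P := F.P K) (j := l) ℰp) j (UkH k h W)) p = GaugeField.plaqHol (𝓥 j) p) ∧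
        (∀ (j : Fin k) (p : Plaq (F.P K) j), p ∈ h j →
          eps1Of (T3Scales F γ hγ (hγ1.trans (sq_min_one_le _ 𝔠.gamma0_pos)) K) 𝔠.lane.carrier j ≤ GaugeGroup.dist1 (GaugeField.plaqHol (𝓥 j) p)) ∧
        -- (3ᵗ) the top constraint for a charged datum
        (ChargedT3 F γ 𝔠.b₀ 𝔠.p₀ (avgWindowFactor F.L) K 𝔠.lane.carrier.M₁
            (rcolOf (T3Scales F γ hγ (hγ1.trans (sq_min_one_le _ 𝔠.gamma0_pos)) K) 𝔠.lane.carrier) k h W →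
          ∀ b : PBond (F.P K) k, b ∈ bondsIn k (Omega 𝔠.lane.carrier.M₁
              (rcolOf (T3Scales F γ hγ (hγ1.trans (sq_min_one_le _ 𝔠.gamma0_pos)) K) 𝔠.lane.carrier) k h k) →
            Averaging.iter (fun i => BlockAveraging.blockAvg (P := F.P K) (j := i) ℰp) k (UkH k h W) b = W b))

end Defs

/-! ## §2 The knit: nested-regular constrained selection ⇒ in-class selection over `𝒞_Xs` -/

section Knit

variable {F : T3Family} {𝔠 : AlphaConsts F.L (suGroupModel 2).N} {γ : ℝ} {hγ : 0 < γ} {hγ1 : γ ≤ (min 𝔠.gamma0 1) ^ 2} {K : ℕ}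

/-- **ONE HISTORY, ONE DATUM: the class membership from the rows.**  At an admissible history `h` of level `k ≤ K`, a configuration `U` with nested regularity (2) at radii `α` in the
windows, (3ʳ)+(ζ) at the recorded plaquettes against frozen data `𝓥`, and (3ᵗ) for charged `W`, lies in `𝒞_Xs(k,h,W)` — `reg68LevelsSet` (★w4 g4), hence `localSmallT3X` (★w6 g2),
`reg68LocalSet` (★w2 g3), `large67RecSet` (★alpha-2 g7), `top42Set` (the top clause). [cite: Balaban1985UV3, (42) p.266, (67)–(68) p.273; Balaban1985Variational, Thm 1 (8) p.279] -/
theorem AlphaInputsT3AC.mem_adaptedClassT3Xs_of_nestedRegular {k : ℕ} (hk : k ≤ K) {h : Hist (F.P K) k}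
    (hh : Hist.Admissible 𝔠.lane.carrier.M₁ (rcolOf (T3Scales F γ hγ (hγ1.trans (sq_min_one_le _ 𝔠.gamma0_pos)) K) 𝔠.lane.carrier) k h)
    (hM₁ : 7 * F.L + 3 ≤ 𝔠.M₁) {W : GaugeField (F.P K) k (Matrix.specialUnitaryGroup (Fin 2) ℂ)}
    {U : GaugeField (F.P K) 0 (Matrix.specialUnitaryGroup (Fin 2) ℂ)} {α : ℕ → ℝ}
    {𝓥 : (j : ℕ) → GaugeField (F.P K) j (Matrix.specialUnitaryGroup (Fin 2) ℂ)}
    (hα : ∀ i, i ≤ k → 0 < α i)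
    (hsmall : ∀ i, i ≤ k → (143 * ((7 : ℝ) ^ 2 / 4) ^ 2) * ((F.L : ℝ) ^ 2 * α i) ≤ 1 / 3 ∧
      2 * ((F.L : ℝ) ^ 2 * α i) ≤ 2 * deltaSU (Fin 2) / ((7 * F.L : ℕ) : ℝ) ^ 2)
    (hwin0 : α 0 ≤ 𝔠.C68 * θBal F.L γ 𝔠.b₀ 𝔠.p₀ K)
    (hwin : ∀ i, 1 ≤ i → i ≤ k → 2 * ((F.L : ℝ) ^ 2 * α (i - 1)) ≤ 𝔠.C68 * θBal F.L γ 𝔠.b₀ 𝔠.p₀ (K - i))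
    (hρ : ∀ j, j ≤ k → α j ≤ 𝔠.C68 / 2 * ((T3Scales F γ hγ (hγ1.trans (sq_min_one_le _ 𝔠.gamma0_pos)) K).gk j *
      pFun 𝔠.lane.carrier.b₀ 𝔠.lane.carrier.p₀ ((T3Scales F γ hγ (hγ1.trans (sq_min_one_le _ 𝔠.gamma0_pos)) K).gk j)))
    (hU : ∀ i, i ≤ k → PlaqSmallOn (↑(plaqsIn 0 (Omega 𝔠.lane.carrier.M₁
        (rcolOf (T3Scales F γ hγ (hγ1.trans (sq_min_one_le _ 𝔠.gamma0_pos)) K) 𝔠.lane.carrier) k h i)) : Set (Plaq (F.P K) 0))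
        (α i * (((F.L : ℝ) ^ i)⁻¹) ^ 2) U)
    (hV : ∀ (j : Fin k) (p : Plaq (F.P K) j), p ∈ h j →
      GaugeField.plaqHol (Averaging.iter (fun l => BlockAveraging.blockAvg (P := F.P K) (j := l) ℰp) j U) p = GaugeField.plaqHol (𝓥 j) p)
    (hrec : ∀ (j : Fin k) (p : Plaq (F.P K) j), p ∈ h j →
      eps1Of (T3Scales F γ hγ (hγ1.trans (sq_min_one_le _ 𝔠.gamma0_pos)) K) 𝔠.lane.carrier j ≤ GaugeGroup.dist1 (GaugeField.plaqHol (𝓥 j) p))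
    (htop : ChargedT3 F γ 𝔠.b₀ 𝔠.p₀ (avgWindowFactor F.L) K 𝔠.lane.carrier.M₁
        (rcolOf (T3Scales F γ hγ (hγ1.trans (sq_min_one_le _ 𝔠.gamma0_pos)) K) 𝔠.lane.carrier) k h W →
      ∀ b : PBond (F.P K) k, b ∈ bondsIn k (Omega 𝔠.lane.carrier.M₁
          (rcolOf (T3Scales F γ hγ (hγ1.trans (sq_min_one_le _ 𝔠.gamma0_pos)) K) 𝔠.lane.carrier) k h k) →
        Averaging.iter (fun i => BlockAveraging.blockAvg (P := F.P K) (j := i) ℰp) k U b = W b) :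
    U ∈ AlphaInputsT3AC.adaptedClassT3Xs F 𝔠 γ hγ hγ1 K k h W := by
  -- r3 ∕ (68) multi-level from the nested fine regularity (★w4 g4)
  have h68 : U ∈ AlphaInputsT3AC.reg68LevelsSet F 𝔠 γ hγ hγ1 K k h :=
    Reg68LevelsOfFineRegular.mem_reg68LevelsSet_of_plaqSmallOn_Omega F 𝔠 γ hγ hγ1 K hk h hα hU hsmall hM₁ hwin0 hwin
  -- small loops at the read bonds (★w6 g2; hypothesis-free from r3)
  have hloc : U ∈ AlphaInputsT3AC.localSmallT3X F 𝔠 γ hγ hγ1 K k h :=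
    AlphaInputsT3AC.reg68LevelsSet_subset_localSmallT3X (𝔠 := 𝔠) (hγ := hγ) (hγ1 := hγ1) hk h h68
  -- the read-local (68) set (★w2 g3), from the same fine regularity read with `≤`
  have hR : U ∈ AlphaInputsT3AC.reg68LocalSet F 𝔠 γ hγ hγ1 K k h :=
    AlphaInputsT3AC.mem_reg68LocalSet_of_regionRegular_le (hγ1 := hγ1) hk hh
      (fun j hj q hq => (hU j hj q hq).le) hρ
  -- (67) in recording currency (★alpha-2 g7): bookkeeping from (3ʳ) + (ζ)
  have hL : U ∈ AlphaInputsT3AC.large67RecSet F 𝔠 γ hγ hγ1 K k h :=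
    AlphaInputsT3AC.mem_large67RecSet_of_plaqHol_eq (hγ1 := hγ1) 𝓥 hV hrec
  exact AlphaInputsT3AC.mem_adaptedClassT3Xs_iff.mpr ⟨hloc, hR, hL, fun hc => ⟨fun b hb => htop hc b hb, h68⟩⟩

/-- ★★★ **B1 EDGES-A — THE IN-CLASS SELECTION ROW OVER `𝒞_Xs` FROM A NESTED-REGULAR CONSTRAINED SELECTION, BY NAME** (the only record row displayed: the collar `7·F.L + 3 ≤ 𝔠.M₁`,
a conjunct of every `PinnedPartsT3ACRec*`). [cite: Balaban1985Variational, Thm 1 (8) p.279, (2)–(3) p.278; Balaban1985UV3, (42) p.266, p.267, (67)–(68) p.273] -/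
theorem AlphaInputsT3AC.inClassSelT3Xs_of_nestedRegularSel (hM₁ : 7 * F.L + 3 ≤ 𝔠.M₁)
    {Ut : (k : ℕ) → GaugeField (F.P K) k (Matrix.specialUnitaryGroup (Fin 2) ℂ) → GaugeField (F.P K) 0 (Matrix.specialUnitaryGroup (Fin 2) ℂ)}
    {UkH : (k : ℕ) → Hist (F.P K) k → GaugeField (F.P K) k (Matrix.specialUnitaryGroup (Fin 2) ℂ) →
      GaugeField (F.P K) 0 (Matrix.specialUnitaryGroup (Fin 2) ℂ)}
    (hsel : AlphaInputsT3AC.NestedRegularSelT3 F 𝔠 γ hγ hγ1 K Ut UkH) :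
    AlphaInputsT3AC.InClassSelT3Xs F 𝔠 γ hγ hγ1 K Ut UkH := by
  obtain ⟨hpin, hmeas, hmem⟩ := hsel
  refine ⟨hpin, hmeas, fun k hk h hh hne W => ?_⟩
  obtain ⟨α, 𝓥, hα, hsmall, hwin0, hwin, hρ, hU, hV, hrec, htop⟩ := hmem k hk h hh hne W
  exact AlphaInputsT3AC.mem_adaptedClassT3Xs_of_nestedRegular hk hh hM₁ hα hsmall hwin0 hwin hρ hU hV hrec htop

end Knit

end Summit.QuantumFields.YangMills.Theorems

end
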